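import Summits.BirchSwinnertonDyer.BirchSwinnertonDyer.Theorems.CMKolyvaginAtInertTwoPointSystemAssemblyOfHloc
import Summits.BirchSwinnertonDyer.BirchSwinnertonDyer.Theorems.CMKolyvaginAtInertTwoPointSystemAtTwoOfPrintedInputs
import Summits.BirchSwinnertonDyer.BirchSwinnertonDyer.Theorems.CMKolyvaginAtInertTwoLevelZeroPrimeHeegnerBSDTwo
import Summits.BirchSwinnertonDyer.BirchSwinnertonDyer.Theorems.SylvesterTwoHeegnerIndexUpperOffV0H44ConcreteSupersingular
import Summits.BirchSwinnertonDyer.BirchSwinnertonDyer.Theorems.KolyvaginRankRigidityAtTwoAdmissibleAtTwo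
import Summits.BirchSwinnertonDyer.BirchSwinnertonDyer.Theorems.CMKolyvaginAtInertTwoKolyvaginPrimeInertAtTwo
import Summits.BirchSwinnertonDyer.Rank1Residual.Partition.MainConjecturesCMInert
import Summits.BirchSwinnertonDyer.Rank1Residual.P2.CMKolyvaginRationalDescentPlumbingAtTwo
import Summits.BirchSwinnertonDyer.Rank1Residual.X11b.KolyvaginLeafInputsDischarged
import Literature.NumberTheory.EllipticCurves.GrossLMS1991.HeegnerEulerSystemCongruenceInert
import Literature.NumberTheory.EllipticCurves.HeegnerPointsOfConductorPrimeLevelProofs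
import Literature.NumberTheory.EllipticCurves.HeegnerPointsOfConductorOneGaloisConjProofs
import HarnessLib

/-!
# Route `CMKolyvaginAtInertTwo`, crux `CMKolyvaginExactAtInertTwo` (stmt-BirchSwinnertonDyer-24277):
# the H₂ point system at `2` and the H₂ level-zero class theorem with Gross 6.2 (1) as the LABELLED
# INPUT `hloc` instead of the printed Gross–Zagier III (3.1) — the socket for the Tamagawa road

Seat `bsd-line-cmk2-p1` g9 (cell `bsd-print-cf2`); helper (`--supports stmt-BirchSwinnertonDyer-24277`).
THEOREMS ONLY (no definition, no named fact, no instance, no `sorry`); no item is closed; BSD is not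
proved by this.

Same compositions as `…PointSystemAtTwoOfPrintedInputs` (p638266) and `…LevelZeroPrimeHeegnerBSDTwoOfPrint`
(p640784), run on `CMPointSystemTwo.hpoints_at_of_perLevelChoice_of_hloc_of_admissible_of_h44` (this seat):
the printed binder `hGZ31` (GZ86 III (3.1)) is replaced by `hloc` — Gross Prop. 6.2 (1) at the finite places
`v ∤ m` for the concrete towers, in the currency a local lemma can supply (admissible `E(K[m])`,
`Γ_K`-invariant `[P(m)]`, `P(m)` fixed by inertia off `m`). On H₂ with `Odd W.tamagawaProduct` the intended
supplier is the Tamagawa road (Milne *ADT* I Prop. 3.8: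
`MilneTamagawa.Milne2006_localTamagawaNumber_smul_unramifiedClass_eq_zero_holds` +
`TamagawaFreePlace.kolyvaginClass_mem_selmerLocalKer_of_inertia_of_localTamagawaNumber_smul` + odd
`c_w(E/K)` at every place — ty2 g23's `Rank1Residual/P2/CMKolyvaginTamagawaSelmerAtTwo.lean`).

* `hpoints_two_of_cmInert_of_hloc` — the machine's `hpoints` at `p = 2` on H₂, full support, every level,
  modulo {`prop37_2_reductionCongruence_inert N W K` by name, `hloc`} (`hrec`, `hCM`, `h53`, `hAdm`, `h44`
  discharged as in p638266, `h53` by `X11b.KolyvaginLeaves.h53_holds`).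
* `bsdp_two_of_levelZero_primeHeegner_of_hloc` — the H₂ level-zero prime-Heegner class theorem: the five
  BSD-side prints + `prop37_2` by name + `hloc` ⟹ `BSDp W 2` (plumbing by ty2 g22's theorems).

HONEST FRAMING: composition; conditional on the displayed named facts and `hloc`; beyond print: no new
mathematics claimed. BSD is not proved by this.
References: [GrossLMS1991] §§3–6, §10; [McCallumLMS1991] §§1–5; [MilneADT2006] I Prop. 3.8, Thm. 4.10;
[GrossZagier1986] I.6.3, V.§2; [BurungaleFlach2024] Thm. 1.1; [Milne1972] Thm. 1.
-/

-- single-conjunct summit: `Summit.BirchSwinnertonDyer.BirchSwinnertonDyer.…` repeats the name by design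
set_option linter.dupNamespace false
set_option autoImplicit false

noncomputable section

open scoped Classical
open WeierstrassCurve Field NumberField IsDedekindDomain Finset
open Literature.NumberTheory.EllipticCurves Literature.NumberTheory.GaloisRepresentations
open Literature.NumberTheory.EllipticCurves.KolyvaginCocycle
open Literature.NumberTheory.EllipticCurves.KolyvaginEuler
open Literature.NumberTheory.EllipticCurves.RingClassField
open Literature.NumberTheory.EllipticCurves.ModularForms
open Literature.NumberTheory.EllipticCurves.Rank1Residual (CMInert)
open Summit.BirchSwinnertonDyer.Rank1Residual.X11b
open Summit.BirchSwinnertonDyer.Rank1Residual.X11b.KolyvaginAssembly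
open Rat.HeightOneSpectrum (primesEquiv)

namespace Summit.BirchSwinnertonDyer.BirchSwinnertonDyer.Theorems.CMPointSystemTwo

-- `K : Type`: the tree's ring-class class field theory is universe `0`.
variable {K : Type} [Field K] [NumberField K] {N : ℕ} {W : WeierstrassCurve ℚ}

/-- **The point system at `2` on H₂ modulo {Gross 3.7 (2) by name, `hloc`}** (module docstring).
[cite: GrossLMS1991, §3 Props. 3.6, 3.7, §4 (4.1), Lemma 4.3, Props. 5.3, 5.4, 6.2]
[cite: McCallumLMS1991, §4 (4)–(6), Lemma 4.3, Prop. 4.4] -/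
theorem hpoints_two_of_cmInert_of_hloc [NeZero N] [W.IsGloballyMinimal] [W.IsElliptic]
    (hN : N = W.conductorNorm ℤ) (hCMW : W.HasCM) (hin : CMInert W 2)
    (hsurj : W.HasSurjectiveModNGaloisRep 2) (hK : IsImaginaryQuadratic K)
    (hodd : Odd (NumberField.discr K)) (h3 : NumberField.discr K ≠ -3)
    (hH : SatisfiesHeegnerHypothesis N K) {P : (W.baseChange K).toAffine.Point}
    (hHP : IsHeegnerPoint N W K P)
    (h372 : GrossLMS1991.prop37_2_reductionCongruence_inert N W K)
    (hloc : ∀ [W.IsElliptic] [W.IsGloballyMinimal] (_hK : IsImaginaryQuadratic K) (ι : K →+* ℂ)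
      {M : ℕ} (_hM : 1 ≤ M) (Dt : ModularParametrizationData W N) {β : ℤ}
      (_hND : IsCoprime (N : ℤ) (NumberField.discr K)) (_hD : NumberField.discr K < -4)
      {n : ℕ} (_hn : Squarefree n)
      (_hKol : ∀ q ∈ n.primeFactors, IsKolyvaginPrime N W K 2 q ∧ FrobEqFrobInfty W K (2 ^ M) q)
      (d : (m : ℕ) → m ∣ n → KolyvaginHeegnerData Dt β ι m)
      (_hA : ∀ (m : ℕ) (hm : m ∣ n),
        IsAdmissible (absoluteGaloisGroup K) (d m hm).pointsSubgroup ((2 ^ M : ℕ) : ℤ))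
      (_hPt : ∀ (m : ℕ) (hm : m ∣ n),
        (d m hm).toGeomPoints (d m hm).derivedPoint ∈
          invPoints (absoluteGaloisGroup K) (d m hm).pointsSubgroup ((2 ^ M : ℕ) : ℤ))
      (_hI : ∀ (m : ℕ) (hm : m ∣ n), ∀ v : HeightOneSpectrum (𝓞 K), (m : 𝓞 K) ∉ v.asIdeal →
        ∀ 𝔐 ∈ v.localPrimesAbove, ∀ t ∈ 𝔐.inertia (absoluteGaloisGroup (v.adicCompletion K)),
          resGal (K := K) (v.adicCompletion K) t • (d m hm).toGeomPoints (d m hm).derivedPoint =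
            (d m hm).toGeomPoints (d m hm).derivedPoint),
      ∀ (m : ℕ) (hm : m ∣ n) (v : HeightOneSpectrum (𝓞 K)), (m : 𝓞 K) ∉ v.asIdeal →
        (d m hm).kolyvaginClass Nat.prime_two M ∈
          selmerLocalKer (W.baseChange K) (v.adicCompletion K) ((2 ^ M : ℕ) : ℤ)) :
    ∀ {M : ℕ} (_hM : 1 ≤ M)
      (hdiv : ∀ Q : geomPoints (W.baseChange K), ∃ R, ((2 ^ M : ℕ) : ℤ) • R = Q)
      (c : K ≃ₐ[ℚ] K) (_hc : c ≠ 1),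
      ∃ (ε : ℤ) (τ : AlgebraicClosure K ≃+* AlgebraicClosure K) (hτ : IsLiftOfAut c τ)
        (A : ℕ → AddSubgroup (geomPoints (W.baseChange K)))
        (hA : ∀ m, KolyvaginCocycle.IsAdmissible (Field.absoluteGaloisGroup K) (A m)
          ((2 ^ M : ℕ) : ℤ))
        (Pt : ℕ → geomPoints (W.baseChange K))
        (hPt : ∀ m, Pt m ∈
          KolyvaginCocycle.invPoints (Field.absoluteGaloisGroup K) (A m) ((2 ^ M : ℕ) : ℤ)),
        (ε = 1 ∨ ε = -1) ∧
        IsOfFinAddOrder (Affine.Point.map (W' := W) (c : K →ₐ[ℚ] K) P - ε • P) ∧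
        (∀ m, ∀ a ∈ A m, hτ.pointsMap W a ∈ A m) ∧
        Pt 1 = toGeomPoints (W.baseChange K) P ∧
        (∀ m : ℕ, Squarefree m →
          (∀ q ∈ m.primeFactors, IsKolyvaginPrime N W K 2 q ∧ FrobEqFrobInfty W K (2 ^ M) q) →
          (∃ B ∈ A m, hτ.pointsMap W (Pt m) =
            (ε * (-1) ^ m.primeFactors.card) • Pt m + ((2 ^ M : ℕ) : ℤ) • B) ∧
          (∀ v : HeightOneSpectrum (𝓞 K), (m : 𝓞 K) ∉ v.asIdeal →
            kolyvaginClass (W.baseChange K) _ hdiv (hA m) (Pt m) (hPt m) ∈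
              selmerLocalKer (W.baseChange K) (v.adicCompletion K) ((2 ^ M : ℕ) : ℤ)) ∧
          (∀ ℓ : ℕ, ℓ.Prime → ℓ ∣ m → ∀ v : HeightOneSpectrum (𝓞 K), (ℓ : 𝓞 K) ∈ v.asIdeal →
            ∀ a : ℕ, ((((2 : ℕ) : ℤ) ^ a) •
                kolyvaginClass (W.baseChange K) _ hdiv (hA m) (Pt m) (hPt m) ∈
                selmerLocalKer (W.baseChange K) (v.adicCompletion K) ((2 ^ M : ℕ) : ℤ) ↔
              (((2 : ℕ) : ℤ) ^ a) • kolyvaginClass (W.baseChange K) _ hdiv (hA (m / ℓ)) (Pt (m / ℓ))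
                  (hPt (m / ℓ)) ∈
                (W.baseChange K).torsionLocalKer (v.adicCompletion K) ((2 ^ M : ℕ) : ℤ)))) := by
  subst hN
  intro M hM hdiv c hc
  have h4 : NumberField.discr K ≠ -4 := fun h ↦ by
    rw [h] at hodd
    exact (Int.not_even_iff_odd.mpr hodd) ⟨-2, by norm_num⟩
  have hD34 : NumberField.discr K ≠ -3 ∧ NumberField.discr K ≠ -4 := ⟨h3, h4⟩
  refine hpoints_at_of_perLevelChoice_of_hloc_of_admissible_of_h44 rfl hK hD34 hH hHP Nat.prime_two
    (heegnerPointOfConductor_one_galoisConj_holds (W.conductorNorm ℤ) W K) ?_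
    (KolyvaginLeaves.h53_holds rfl 2) hloc ?_ ?_ hM hdiv c hc
  · intro _ hK' _ Dt β ι hβ M _ m hm _
    exact phi_heegnerPointOfConductor_mem_range_map_ringClassField_of_ne_zero (W.conductorNorm ℤ) W K
      hK' Dt β ι m hβ (Squarefree.ne_zero hm)
  · intro Dt β ι M n hn _ d
    exact KolyvaginAtTwo.isAdmissible_pointsSubgroup_two_of_heegner d hsurj hK hodd hH
      (Squarefree.ne_zero hn) M
  · intro _ _ hK' ι P' hHP' M' hM' Dt β' hND hD n' hn hKol d hcoh hA hPt hI
    exact SylvesterTwoUpper.h44_concrete_of_traceRelation_of_congruence_of_supersingular hK' ι hHP'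
      Nat.prime_two hM'
      (fun ℓ hℓ _ ↦ frobeniusTrace_eq_zero_of_isKolyvaginPrime_two_of_cmInert hCMW hin hsurj hℓ)
      Dt hND hD hn hKol d hcoh
      (h372.family_of_grossKolyvaginPrime rfl hK' hD34 hH Dt β' ι hn
        (fun q hq ↦ (hKol q hq).1.2.2.2.1) (fun q hq ↦ (hKol q hq).1) d)
      hA hPt hI

end Summit.BirchSwinnertonDyer.BirchSwinnertonDyer.Theorems.CMPointSystemTwo

namespace Summit.BirchSwinnertonDyer.BirchSwinnertonDyer.Theorems.CMLevelZeroTwo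

open Literature.NumberTheory.EllipticCurves.Rank1Residual

/-- **The H₂ level-zero prime-Heegner class theorem with `hloc` in place of GZ III (3.1)** (module
docstring): the five BSD-side named facts + Gross 3.7 (2) by name + `hloc` ⟹ `BSD₂(W)` for `W ∈ H₂`, `K`
prime Heegner, a frame with `y_K` of infinite order and `y_K ∉ 2E(K[1])`.
[cite: GrossLMS1991, §1 (1.2), Prop. 2.1 with §10, Props. 3.7, 5.4, 6.2] [cite: McCallumLMS1991, §1, §5]
[cite: GrossZagier1986, Thm. I.6.3, V.§2] [cite: BurungaleFlach2024, Thm. 1.1 and Cor. 2]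
[cite: Milne1972ArithmeticAV, §1 Thm. 1] -/
theorem bsdp_two_of_levelZero_primeHeegner_of_hloc (hmod : exists_isNewformOf)
    (hGZall : ∀ (N : ℕ) [NeZero N] (W : WeierstrassCurve ℚ) (K : Type) [Field K] [NumberField K],
      gross_zagier N W K)
    (hGZK : rank_eq_analyticRank_of_analyticRank_le_one)
    (hMilne : Milne1972.bsdQuotient_baseChange_quadratic_anyModel)
    (hBF : bsdTriple_of_hasCM_of_L_one_ne_zero)
    (W : WeierstrassCurve ℚ) [W.IsElliptic] [W.IsGloballyMinimal] [NeZero (W.conductorNorm ℤ)]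
    (hCM : W.HasCM) (hin : CMInert W 2) (hsurj : W.HasSurjectiveModNGaloisRep (2 : ℤ))
    (hr : W.analyticRank = 1) (hT : Odd W.tamagawaProduct)
    (K : Type) [Field K] [NumberField K] (hK : IsImaginaryQuadratic K) (hodd : Odd (discr K))
    (h3 : discr K ≠ -3) (hH : SatisfiesHeegnerHypothesis (W.conductorNorm ℤ) K)
    {q : ℕ} (hq : q.Prime) (hd : discr K = -(q : ℤ))
    (h372 : GrossLMS1991.prop37_2_reductionCongruence_inert (W.conductorNorm ℤ) W K)
    (hloc : ∀ [W.IsElliptic] [W.IsGloballyMinimal] (_hK : IsImaginaryQuadratic K) (ι : K →+* ℂ)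
      {M : ℕ} (_hM : 1 ≤ M) (Dt : ModularParametrizationData W (W.conductorNorm ℤ)) {β : ℤ}
      (_hND : IsCoprime ((W.conductorNorm ℤ) : ℤ) (NumberField.discr K)) (_hD : NumberField.discr K < -4)
      {n : ℕ} (_hn : Squarefree n)
      (_hKol : ∀ q ∈ n.primeFactors, IsKolyvaginPrime (W.conductorNorm ℤ) W K 2 q ∧ FrobEqFrobInfty W K (2 ^ M) q)
      (d : (m : ℕ) → m ∣ n → KolyvaginHeegnerData Dt β ι m)
      (_hA : ∀ (m : ℕ) (hm : m ∣ n),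
        IsAdmissible (absoluteGaloisGroup K) (d m hm).pointsSubgroup ((2 ^ M : ℕ) : ℤ))
      (_hPt : ∀ (m : ℕ) (hm : m ∣ n),
        (d m hm).toGeomPoints (d m hm).derivedPoint ∈
          invPoints (absoluteGaloisGroup K) (d m hm).pointsSubgroup ((2 ^ M : ℕ) : ℤ))
      (_hI : ∀ (m : ℕ) (hm : m ∣ n), ∀ v : HeightOneSpectrum (𝓞 K), (m : 𝓞 K) ∉ v.asIdeal →
        ∀ 𝔐 ∈ v.localPrimesAbove, ∀ t ∈ 𝔐.inertia (absoluteGaloisGroup (v.adicCompletion K)),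
          resGal (K := K) (v.adicCompletion K) t • (d m hm).toGeomPoints (d m hm).derivedPoint =
            (d m hm).toGeomPoints (d m hm).derivedPoint),
      ∀ (m : ℕ) (hm : m ∣ n) (v : HeightOneSpectrum (𝓞 K)), (m : 𝓞 K) ∉ v.asIdeal →
        (d m hm).kolyvaginClass Nat.prime_two M ∈
          selmerLocalKer (W.baseChange K) (v.adicCompletion K) ((2 ^ M : ℕ) : ℤ))
    (Dt : ModularParametrizationData W (W.conductorNorm ℤ))
    (hopt : ∀ z ∈ Dt.L.lattice, ∃ w ∈ periodLattice Dt.f, z = (Dt.c : ℂ) * w) (hc : Odd Dt.c)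
    (β : ℤ) (ι : K →+* ℂ) (d₁ : KolyvaginHeegnerData Dt β ι 1) (hy : ¬ IsOfFinAddOrder d₁.derivedPoint)
    (h2 : ¬ ∃ Q : (W.baseChange (ringClassField K ι 1)).toAffine.Point, (2 : ℤ) • Q = d₁.derivedPoint) :
    BSDp W 2 := by
  obtain ⟨u, hu⟩ : ∃ u : HeightOneSpectrum (𝓞 ℚ), ((primesEquiv u : Nat.Primes) : ℕ) = q :=
    ⟨primesEquiv.symm ⟨q, hq⟩, by rw [Equiv.apply_symm_apply]⟩
  refine bsdp_two_of_levelZero_primeHeegner_of_pointSystem_of_plumbing hmod hGZall hGZK hMilne hBF W hCM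
    hin hsurj hr hT K hK hodd h3 hH hq hd u hu Dt hopt hc β ι d₁ hy h2 ?_
    (Rank1Residual.P2.RationalDescentPlumbing.htower_two_pow_one W K)
    (Rank1Residual.P2.RationalDescentPlumbing.hdescfin_two_pow_one W hK hH hq hd u hu)
  intro P₀ hP₀ M hM hdiv c hc
  exact Classical.choice (by
    obtain ⟨ε, τ, hτ, A, hA, Pt, hPt, hε, hc1, hAτ, hPt1, hrel⟩ :=
      CMPointSystemTwo.hpoints_two_of_cmInert_of_hloc (N := W.conductorNorm ℤ) rfl hCM hin hsurj hK hodd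
        h3 hH hP₀ h372 hloc hM hdiv c hc
    exact ⟨⟨ε, τ, hτ, A, hA, Pt, hPt, hε, hc1, hAτ, hPt1,
      fun m hm hq' ↦ hrel m hm fun q hq'' ↦ ⟨(hq' q hq'').1, (hq' q hq'').2.1⟩⟩⟩)

end Summit.BirchSwinnertonDyer.BirchSwinnertonDyer.Theorems.CMLevelZeroTwo

end
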